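import Mathlib
import Summits.Ventures.HodgeRepro2.T5PrimitiveOneOne
import Summits.Ventures.HodgeRepro2.T5L2Positivity

/-!
# T5OneOneNegativity — Theorem 6.32 at `(p,q) = (1,1)` in the global coframe model: the integral of
`γ ∧ γ̄` over the compact surface is `≤ 0` for a primitive `(1,1)`-form `γ`, and `< 0` iff `γ ≠ 0`
(Tier-5 N1 Hodge-side support, seat p6)

Global model of `T5L2Positivity` / `T5TwoZeroPositivity` (rows 27 / 30 of route/LEAN-ANNEX-p6.md):
`S` a compact topological space with a Borel measure `μ = Vol_S` finite on compacts and positive on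
non-empty open sets; a `(1,1)`-form is a continuous coefficient field `c : S → Fin 2 → Fin 2 → ℂ`
(`γ_s = Σ c_ij(s) dz_i ∧ dz̄_j` in the unitary coframe at `s`, `T5KahlerModel.oneOne`), primitive when
`trace (c s) = 0` at every point (`ω ∧ γ = 0`, `T5PrimitiveOneOne.wedge_kahler_oneOne_eq_zero_iff`);
the period `∫_S γ ∧ γ̄` is the integral of the `Vol`-coefficient `wedge γ_s (conjC γ_s)`.

Printed input: Voisin, held copy, p0128 l. 35 (Theorem 6.32: `(−1)^{k(k−1)/2} i^{p−q−k} H_k` is positive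
definite on `H^{p,q}_{prim}`, `H_k(α, β) = i^k ∫ ω^{n−k} ∧ α ∧ β̄`), at `k = n = 2`, `(p,q) = (1,1)`, where
the sign is `(−1)^{1} i^{−2} = 1`, i.e. `H_2(γ, γ) = −∫_S γ ∧ γ̄ > 0`.

What is kernel-checked here (composition of the pointwise `T5PrimitiveOneOne` with row 27's
integration lemmas): `integral_wedge_oneOne_self` (`∫_S γ ∧ γ̄ = −∫_S |γ|² dVol`, real),
`integral_wedge_oneOne_self_re_nonpos`, `integral_wedge_oneOne_self_eq_zero_iff` (`= 0 ↔ c = 0`),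
`integral_wedge_oneOne_self_re_neg_iff` (`< 0 ↔ c ≠ 0`) and `thm632_oneOne_global_pos_iff` (the printed
form). The companion of `T5TwoZeroPositivity.integral_wedge_self_re_pos_iff` (`(2,0)`: `> 0`) — the two
signs of the Hodge index on a surface, in the model.

Honest scope: model level — the coefficient field is the form in the unitary coframe; the bundle-
versus-trivialisation bookkeeping, Voisin (5.1) as the definition of the `L²` product, and Theorem
6.32 as a statement about harmonic representatives of cohomology classes stay prose. Not used by the
N1 chain (which needs `(2,0)`); nothing automorphic.
-/

namespace Summit.Ventures.HodgeRepro2.T5OneOneNegativity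

open MeasureTheory Complex T5HodgeStar T5KahlerModel T5PrimitiveOneOne

/-- `Σ c_ij dz_i ∧ dz̄_j = 0` iff every `c_ij = 0` (the four covectors `dz_i ∧ dz̄_j` are independent). -/
theorem oneOne_eq_zero_iff (c : Fin 2 → Fin 2 → ℂ) : oneOne c = 0 ↔ c = 0 := by
  constructor
  · intro h
    have h0 := congrFun h 0
    have h1 := congrFun h 1
    have h2 := congrFun h 2
    have h5 := congrFun h 5
    simp [oneOne, dz1dzbar1, dz1dzbar2, dz2dzbar1, dz2dzbar2] at h0 h1 h2 h5
    funext i j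
    fin_cases i <;> fin_cases j
    · simpa using h0
    · show c 0 1 = 0
      linear_combination (h1 + I * h2) / 2 + ((c 0 1 + c 1 0) / 2) * I_sq
    · show c 1 0 = 0
      linear_combination (-h1 + I * h2) / 2 + ((c 0 1 + c 1 0) / 2) * I_sq
    · simpa using h5
  · intro h; subst h; ext i; fin_cases i <;> simp [oneOne]

/-- The pointwise density vanishes identically iff the form does. -/
theorem density_eq_zero_iff {S : Type*} (c : S → Fin 2 → Fin 2 → ℂ) :
    (fun s => ∑ i, normSq (oneOne (c s) i)) = 0 ↔ c = 0 := by
  constructor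
  · intro h
    funext s
    have hs := congrFun h s
    simp only [Pi.zero_apply] at hs
    have h' := (Finset.sum_eq_zero_iff_of_nonneg fun i _ => normSq_nonneg (oneOne (c s) i)).mp hs
    have : oneOne (c s) = 0 := funext fun i => normSq_eq_zero.mp (h' i (Finset.mem_univ i))
    exact (oneOne_eq_zero_iff (c s)).mp this
  · intro h; subst h; funext s; simp [oneOne]

/-- The pointwise density `|γ_s|² = Σ_i |(γ_s)_i|²` is continuous. -/
theorem continuous_density {S : Type*} [TopologicalSpace S] {c : S → Fin 2 → Fin 2 → ℂ}
    (hc : Continuous c) : Continuous fun s => ∑ i, normSq (oneOne (c s) i) := by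
  refine continuous_finsetSum _ fun i _ => Complex.continuous_normSq.comp ?_
  have hij : ∀ a b : Fin 2, Continuous fun s => c s a b := fun a b =>
    (continuous_apply b).comp ((continuous_apply a).comp hc)
  simp only [oneOne, Pi.add_apply, Pi.smul_apply, smul_eq_mul]
  fun_prop

section Integral

variable {S : Type*} [MeasurableSpace S] {μ : Measure S}

/-- `∫_S γ ∧ γ̄ = −∫_S |γ|² dVol_S` for a primitive `(1,1)`-form `γ` (the integral of the pointwise
`T5PrimitiveOneOne.wedge_conjC_oneOne_of_trace_eq_zero`); in particular the period is real. -/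
theorem integral_wedge_oneOne_self (c : S → Fin 2 → Fin 2 → ℂ) (hc : ∀ s, trace (c s) = 0) :
    ∫ s, wedge (oneOne (c s)) (conjC (oneOne (c s))) ∂μ =
      -((∫ s, ∑ i, normSq (oneOne (c s) i) ∂μ : ℝ) : ℂ) := by
  have h : ∀ s, wedge (oneOne (c s)) (conjC (oneOne (c s))) =
      -((∑ i, normSq (oneOne (c s) i) : ℝ) : ℂ) := fun s => by
    rw [wedge_conjC_oneOne_of_trace_eq_zero _ _ (hc s), herm_self_eq_sum_normSq]
  simp_rw [h]
  rw [integral_neg, integral_complex_ofReal]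

/-- The period of a primitive `(1,1)`-form against itself has non-positive real part. -/
theorem integral_wedge_oneOne_self_re_nonpos (c : S → Fin 2 → Fin 2 → ℂ) (hc : ∀ s, trace (c s) = 0) :
    (∫ s, wedge (oneOne (c s)) (conjC (oneOne (c s))) ∂μ).re ≤ 0 := by
  rw [integral_wedge_oneOne_self c hc, Complex.neg_re, Complex.ofReal_re]
  exact neg_nonpos.mpr (T5L2Positivity.integral_nonneg_of_nonneg fun s =>
    Finset.sum_nonneg fun i _ => normSq_nonneg _)

/-- The period of a primitive `(1,1)`-form against itself is real. -/
theorem integral_wedge_oneOne_self_im (c : S → Fin 2 → Fin 2 → ℂ) (hc : ∀ s, trace (c s) = 0) :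
    (∫ s, wedge (oneOne (c s)) (conjC (oneOne (c s))) ∂μ).im = 0 := by
  rw [integral_wedge_oneOne_self c hc, Complex.neg_im, Complex.ofReal_im, neg_zero]

end Integral

section Global

variable {S : Type*} [MeasurableSpace S] {μ : Measure S} [TopologicalSpace S] [OpensMeasurableSpace S]
  [CompactSpace S] [IsFiniteMeasureOnCompacts μ] [μ.IsOpenPosMeasure]

/-- `∫_S γ ∧ γ̄ = 0 ↔ γ = 0` for a continuous primitive `(1,1)`-form on the compact surface. -/
theorem integral_wedge_oneOne_self_eq_zero_iff {c : S → Fin 2 → Fin 2 → ℂ} (hcont : Continuous c)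
    (hc : ∀ s, trace (c s) = 0) :
    ∫ s, wedge (oneOne (c s)) (conjC (oneOne (c s))) ∂μ = 0 ↔ c = 0 := by
  rw [integral_wedge_oneOne_self c hc, neg_eq_zero, Complex.ofReal_eq_zero,
    T5L2Positivity.integral_eq_zero_iff_of_continuous (continuous_density hcont)
      (fun s => Finset.sum_nonneg fun i _ => normSq_nonneg _)]
  exact density_eq_zero_iff c

/-- `(∫_S γ ∧ γ̄).re < 0 ↔ γ ≠ 0`: the global Hodge index at `(1,1)` in the model (the companion of
`T5TwoZeroPositivity.integral_wedge_self_re_pos_iff`). -/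
theorem integral_wedge_oneOne_self_re_neg_iff {c : S → Fin 2 → Fin 2 → ℂ} (hcont : Continuous c)
    (hc : ∀ s, trace (c s) = 0) :
    (∫ s, wedge (oneOne (c s)) (conjC (oneOne (c s))) ∂μ).re < 0 ↔ c ≠ 0 := by
  rw [integral_wedge_oneOne_self c hc, Complex.neg_re, Complex.ofReal_re, neg_neg_iff_pos,
    T5L2Positivity.integral_pos_iff_of_continuous (continuous_density hcont)
      (fun s => Finset.sum_nonneg fun i _ => normSq_nonneg _)]
  constructor
  · rintro ⟨s, hs⟩ h0
    subst h0
    simp [oneOne] at hs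
  · intro h
    by_contra h'
    apply h
    apply (density_eq_zero_iff c).mp
    funext s
    by_contra hs
    exact h' ⟨s, hs⟩

/-- Theorem 6.32 at `n = k = 2`, `(p,q) = (1,1)`, in the global model: the form
`(−1)^{k(k−1)/2} i^{p−q−k} H_2`, `H_2(γ, γ) = i^2 ∫_S γ ∧ γ̄`, is positive on every continuous primitive
`(1,1)`-form `γ ≠ 0`. -/
theorem thm632_oneOne_global_pos_iff {c : S → Fin 2 → Fin 2 → ℂ} (hcont : Continuous c)
    (hc : ∀ s, trace (c s) = 0) :
    0 < ((((-1 : ℂ) ^ (2 * (2 - 1) / 2 : ℕ)) * I ^ ((1 : ℤ) - 1 - 2)) *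
      (I ^ (2 : ℕ) * ∫ s, wedge (oneOne (c s)) (conjC (oneOne (c s))) ∂μ)).re ↔ c ≠ 0 := by
  rw [thm632_sign_oneOne, one_mul, I_sq, neg_one_mul, Complex.neg_re, neg_pos]
  exact integral_wedge_oneOne_self_re_neg_iff hcont hc

end Global

end Summit.Ventures.HodgeRepro2.T5OneOneNegativity
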